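import Summits.NavierStokesRegularity.NavierStokesRegularity.Theorems.ScenarioCensusScrewBlowdownOffAxis
import HarnessLib

/-!
# LINE «screw-blowdown» port, part 6/13: v1.5 `farPast_linearCone_smallness_of_screw`

Re-homed for the scenario census (typer seat ns-census-typer-1 g7; lead g9 RULINGS [7] 20:33Z / [8] 21:03Z / [12](b) 21:58Z: «screw-blowdown v1.8 =
version of record; `Row_A13isqT` DECIDED IN KERNEL → CANDIDATE-DECIDED member under A13 (row already TREE); typer-1 slot 3 port of record =
`ScrewBlowdown_port_v1_8.lean` bb5f719a8be448dd (stub-free)»; lead g10 RULINGS [1](b) 22:36Z / [2] 22:42Z: «port v1.9 ffe1ad3d1d25e376 = port of record (idea-crit-3 DIFF-CHECK 22:40:40Z CONFORMS); slot 4 = its S3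
appendix ADMISSIBLE after slot 3»; ref PRE-CHECKs items 13 / 15 / 20 / 27): VERBATIM PORT of ns-idea-4 LINE g12-1 «screw-blowdown» PORT copy
`pub/ideators/ns-idea-4/lines/screw-blowdown/port/ScrewBlowdown_port_v1_9.lean` sha16 ffe1ad3d1d25e376 (2890 l.; lean check rc 0, 0 sorry; = the v1.8
port copy bb5f719a8be448dd as a literal prefix — itself the v1.7 copy 674e939b7b0b34e8 + the `LocalPersistence` attack appendix `…LP` + the consequences
`localPersistence_holds` / `farPastSpreading_holds` / `linearConeLiouville_holds` / `row_A13isqT_proved` — plus the v1.9 S3 block: `vanishingBlowdownLiouville_holds`,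
`row_ArecT_proved`; parts 1–3 landed while v1.8 was the copy of record, text identical),
split for the 400-line rule into `ScenarioCensusScrewBlowdown` (§1–§3: objects, the cell `Row_A13isqT`, obligation Props, S1 PROVED) →
`…Plumbing` (§4, S2 PROVED) → `…Bridges` (§5 + v1.3) → `…Recurrent` (v1.4, `Row_ArecT`) → `…OffAxis` (v1.5 a) → `…Cone` (v1.5 b:
`farPast_linearCone_smallness_of_screw`) → `…Residual` (v1.5 c + v1.6: `LinearConeLiouville`, DSS rungs) → `…Propagation` (v1.7: FS, LP,
reductions; the three class-general tools are NOT re-declared — taken BY NAME, general `E`, from `Theorems/TypeIAncientMildForwardUniqueness.lean`,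
ns-idea-4 extract a1b589f6dec7da83, p671177) → `…LPTools` / `…LPDuhamel` / `…LP` (the appendix: Gaussian locality, the three-term Oseen split,
time weights; `duhamel_bound`; the bootstrap `one_step` / `persist` / `localPersistence` + the consequences incl. `row_A13isqT_proved`) →
`…Vanishing` (v1.9: S3 proved, `row_ArecT_proved`) → `…Keys` (census keys `Row_A13isqT` / `Row_ArecT` + `_excluded`).  Lean text VERBATIM in namespaces `…Theorems.ScenarioCensus.ScrewBlowdown` / `…ScrewBlowdownLP` (the line's
`…Lines.ScrewBlowdownPort` / `…PortLP` re-homed; qualified references renamed accordingly); port edits: `local notation "E3"` → `abbrev E3` (the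
appendix `open`s it), `@[conjecture]` on `VanishingBlowdownLiouville` only (part 1 landed while S3 was open; an obligation node, now with the closed
witness `vanishingBlowdownLiouville_holds`), seven one-line docstrings added, `continuous_rotZ_angle'` not re-declared (it restates the tree's
`Literature.Analysis.FluidPDE.continuous_rotZ_angle`, gate lint `dedup.landed`; its uses renamed), the line's `set_option linter.unusedVariables false` dropped (five proof lambdas
bind the unused `θ₀ h` as `_ _`; the unused hypothesis binders of `hasVanishingBlowdown_of_axiallyRecurrent` / `pointwise_small_of_zoom_small` are spelled `_hu` / `_hΛ`,
statements otherwise identical); `set_option maxHeartbeats … in` of the appendix kept as in the line.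

No census VALUE is moved by this file (row A13 is TREE already; the lead books the member A13isq-T); NS regularity is NOT proved; (L′)
`SymmetryModuliCount.TypeIAncientLiouville` is untouched (hypothesis of bridges only); no summit statement is proved by this file.
-/

-- the summit and its single problem share the name `NavierStokesRegularity` (D-0017 nested layout)
set_option linter.dupNamespace false

namespace Summit.NavierStokesRegularity.NavierStokesRegularity.Theorems.ScenarioCensus.ScrewBlowdown

open Set Function Filter Topology
open Literature.Analysis Literature.Analysis.FluidPDE
open Summit.NavierStokesRegularity.NavierStokesRegularity.Theorems

set_option maxHeartbeats 400000 in
/-- **Far-past smallness on LINEAR CONES (v1.5, PROVED; positive drift).**  For a Type-I ancient mild field equivariant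
under ONE screw of irrational turn and drift `h > 0`: for every `ε, K > 0` there is `T < 0` with `√(−t)‖u(t,x)‖ ≤ ε`
whenever `t < T` and `|x_h| ≤ K(−t)` (i.e. `x₀² + x₁² ≤ K² t²`).  Proof: violating points `(t_k, x_k)`; slab reduction;
`μ_k = √(−t_k)`, `R_k = |x_{k,h}| ≤ K μ_k²`.  If `R_k/μ_k` stays bounded: the on-axis blow-down vanishes (v1.3 mechanism).
Otherwise along a subsequence `R_k/μ_k → ∞`: zoom around `x_k`, the Dirichlet power gives symmetries `(R_{ψ_k}, d_k)`,
`ψ_k → 0`, `1/4 ≤ ‖d_k‖² `, `‖d_k‖ ≤ 2A₀`; extract a blow-down `W` (tree), `‖W(−1,0)‖ ≥ ε`; a convergent subsequence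
`d_k → d₀ ≠ 0` makes `W` periodic, so `W ≡ 0` by `periodic_typeI_liouville_genuine` — contradiction. -/
theorem farPast_linearCone_smallness_of_screw_pos {C : ℝ} {u : ℝ → E3 → E3} {θ₀ h : ℝ}
    (hu : IsTypeIAncientMild C u) (hθ : Irrational (θ₀ / (2 * Real.pi))) (hh : 0 < h)
    (hS : IsScrewEquivariant θ₀ h u) :
    ∀ ε > (0 : ℝ), ∀ K > (0 : ℝ), ∃ T < (0 : ℝ), ∀ t < T, ∀ x : E3,
      x 0 ^ 2 + x 1 ^ 2 ≤ K ^ 2 * t ^ 2 → Real.sqrt (-t) * ‖u t x‖ ≤ ε := by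
  by_contra H
  push Not at H
  obtain ⟨ε, hε, K, hK, H⟩ := H
  have H' : ∀ k : ℕ, ∃ t, t < -((k : ℝ) + 1 + h ^ 2) ∧ ∃ x : E3,
      x 0 ^ 2 + x 1 ^ 2 ≤ K ^ 2 * t ^ 2 ∧ ε < Real.sqrt (-t) * ‖u t x‖ := by
    intro k
    have hpos : (0 : ℝ) < (k : ℝ) + 1 + h ^ 2 := by positivity
    exact H _ (by linarith)
  choose t ht x hx hbig using H'
  have htk : ∀ k : ℕ, (k : ℝ) + 1 + h ^ 2 < -t k := fun k => by linarith [ht k]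
  have htneg : ∀ k, t k < 0 := fun k => by
    have hpos : (0 : ℝ) < (k : ℝ) + 1 + h ^ 2 := by positivity
    linarith [ht k]
  -- move each point into the fundamental slab
  have Hs : ∀ k, ∃ x' : E3, x' 0 ^ 2 + x' 1 ^ 2 = x k 0 ^ 2 + x k 1 ^ 2 ∧ 0 ≤ x' 2 ∧ x' 2 ≤ h ∧
      ‖u (t k) x'‖ = ‖u (t k) (x k)‖ := fun k => exists_slab_point_pos hS hh (htneg k) (x k)
  choose x' hx'1 hx'2 hx'3 hx'4 using Hs
  -- the scales
  obtain ⟨μ, hμdef⟩ : ∃ μ : ℕ → ℝ, ∀ k, μ k = Real.sqrt (-t k) := ⟨_, fun k => rfl⟩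
  have hμpos : ∀ k, 0 < μ k := fun k => by rw [hμdef]; exact Real.sqrt_pos.2 (by linarith [htneg k])
  have hμsq : ∀ k, μ k ^ 2 = -t k := fun k => by rw [hμdef]; exact Real.sq_sqrt (by linarith [htneg k])
  have hμone : ∀ k, 1 ≤ μ k := fun k => by
    rw [hμdef, ← Real.sqrt_one]
    exact Real.sqrt_le_sqrt (by nlinarith [htk k, (Nat.cast_nonneg k : (0 : ℝ) ≤ k), sq_nonneg h])
  have hμh : ∀ k, h ≤ μ k := fun k => by
    rw [hμdef, ← Real.sqrt_sq hh.le]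
    exact Real.sqrt_le_sqrt (by nlinarith [htk k, (Nat.cast_nonneg k : (0 : ℝ) ≤ k)])
  have hμlim : Tendsto μ atTop atTop := by
    have h1 : Tendsto (fun k : ℕ => Real.sqrt ((k : ℝ) + 1)) atTop atTop :=
      Real.tendsto_sqrt_atTop.comp (tendsto_atTop_add_const_right _ _ tendsto_natCast_atTop_atTop)
    refine tendsto_atTop_mono (fun k => ?_) h1
    rw [hμdef]
    exact Real.sqrt_le_sqrt (by nlinarith [htk k, sq_nonneg h])
  -- horizontal radii
  obtain ⟨R, hRdef⟩ : ∃ R : ℕ → ℝ, ∀ k, R k = Real.sqrt (x' k 0 ^ 2 + x' k 1 ^ 2) := ⟨_, fun k => rfl⟩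
  have hR0 : ∀ k, 0 ≤ R k := fun k => by rw [hRdef]; exact Real.sqrt_nonneg _
  have hRsq : ∀ k, R k ^ 2 = x' k 0 ^ 2 + x' k 1 ^ 2 := fun k => by
    rw [hRdef]; exact Real.sq_sqrt (by positivity)
  have hRK : ∀ k, R k ≤ K * μ k ^ 2 := by
    intro k
    have h1 : R k ^ 2 ≤ (K * μ k ^ 2) ^ 2 := by
      rw [hRsq, hx'1]
      calc x k 0 ^ 2 + x k 1 ^ 2 ≤ K ^ 2 * t k ^ 2 := hx k
        _ = (K * μ k ^ 2) ^ 2 := by rw [hμsq]; ring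
    exact (pow_le_pow_iff_left₀ (hR0 k) (by positivity) two_ne_zero).1 h1
  have hlarge : ∀ k, ε < μ k * ‖u (t k) (x' k)‖ := fun k => by rw [hx'4, hμdef]; exact hbig k
  by_cases hb : ∃ M : ℝ, ∀ k, R k ≤ M * μ k
  · /- Case A: parabolic regime — the on-axis blow-down vanishes (v1.3 mechanism). -/
    obtain ⟨M, hM⟩ := hb
    obtain ⟨y, hydef⟩ : ∃ y : ℕ → E3, ∀ k, y k = (μ k)⁻¹ • x' k := ⟨_, fun k => rfl⟩
    have hy0 : ∀ k, y k 0 ^ 2 + y k 1 ^ 2 ≤ M ^ 2 := by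
      intro k
      have e : y k 0 ^ 2 + y k 1 ^ 2 = (μ k)⁻¹ ^ 2 * R k ^ 2 := by
        rw [hRsq]; simp only [hydef, PiLp.smul_apply, smul_eq_mul]; ring
      have h1 : R k ^ 2 ≤ (M * μ k) ^ 2 := pow_le_pow_left₀ (hR0 k) (hM k) 2
      have hμ0 : μ k ≠ 0 := (hμpos k).ne'
      rw [e]
      calc (μ k)⁻¹ ^ 2 * R k ^ 2 ≤ (μ k)⁻¹ ^ 2 * (M * μ k) ^ 2 :=
            mul_le_mul_of_nonneg_left h1 (by positivity)
        _ = M ^ 2 := by field_simp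
    have hy2 : ∀ k, 0 ≤ y k 2 := fun k => by
      simp only [hydef, PiLp.smul_apply, smul_eq_mul]
      exact mul_nonneg (inv_nonneg.2 (hμpos k).le) (hx'2 k)
    have hy3 : ∀ k, y k 2 ≤ h := fun k => by
      simp only [hydef, PiLp.smul_apply, smul_eq_mul]
      calc (μ k)⁻¹ * x' k 2 ≤ 1 * x' k 2 :=
            mul_le_mul_of_nonneg_right (inv_le_one_of_one_le₀ (hμone k)) (hx'2 k)
        _ ≤ h := by rw [one_mul]; exact hx'3 k
    have hmem : ∀ k, y k ∈ Metric.closedBall (0 : E3) (Real.sqrt (M ^ 2 + h ^ 2)) := fun k => by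
      rw [Metric.mem_closedBall, dist_zero_right]
      exact norm_le_of_slab (hy0 k) (hy2 k) (hy3 k)
    have hval : ∀ k, nsRescale (μ k) u (-1) (y k) = μ k • u (t k) (x' k) := by
      intro k
      simp only [nsRescale, hydef, smul_smul, mul_inv_cancel₀ (hμpos k).ne', one_smul]
      congr 2
      rw [hμsq k]; ring
    have hlarge' : ∀ k, ε < ‖nsRescale (μ k) u (-1) (y k)‖ := by
      intro k
      rw [hval k, norm_smul, Real.norm_eq_abs, abs_of_pos (hμpos k)]
      exact hlarge k
    obtain ⟨φ, hφ, W, hW, -, -, hloc, -⟩ :=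
      exists_tendsto_of_isTypeIAncientMild_seq C (w := fun k => nsRescale (μ k) u)
        fun k => isTypeIAncientMild_nsRescale hu (hμpos k)
    have hBD : IsBlowdownLimit C u W :=
      ⟨hW, fun k => μ (φ k), fun k => hμpos _, hμlim.comp hφ.tendsto_atTop, fun t ht => hloc t ht⟩
    have hW0 : ∀ t < (0 : ℝ), ∀ x, W t x = 0 := hasVanishingBlowdown_of_screw' hu hθ hh.ne' hS W hBD
    obtain ⟨ys, -, ψ, hψ, hys⟩ :=
      tendsto_subseq_of_bounded (Metric.isBounded_closedBall) (fun i => hmem (φ i))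
    have hsub : TendstoLocallyUniformly (fun i => nsRescale (μ (φ (ψ i))) u (-1)) (W (-1)) atTop :=
      tendstoLocallyUniformly_subseq (hloc (-1) (by norm_num)) hψ
    have hcontW : Continuous (W (-1)) := hW.continuous_slice (by norm_num)
    have hys' : Tendsto (fun i => y (φ (ψ i))) atTop (𝓝 ys) := hys
    have hL : Tendsto (fun i => nsRescale (μ (φ (ψ i))) u (-1) (y (φ (ψ i)))) atTop (𝓝 (W (-1) ys)) :=
      hsub.tendsto_comp hcontW.continuousAt hys'
    rw [hW0 (-1) (by norm_num) ys] at hL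
    have hnorm : Tendsto (fun i => ‖nsRescale (μ (φ (ψ i))) u (-1) (y (φ (ψ i)))‖) atTop (𝓝 0) := by
      have h0 := hL.norm
      rwa [norm_zero] at h0
    obtain ⟨i, hi⟩ := (hnorm.eventually (gt_mem_nhds hε)).exists
    exact absurd (hlarge' (φ (ψ i))) (not_lt.2 hi.le)
  · /- Case B: off-axis regime — linearised screw powers make the blow-down periodic. -/
    push Not at hb
    have hfreq : ∀ n : ℕ, ∃ᶠ k in atTop, (n : ℝ) * μ k < R k := by
      intro n
      rw [Filter.frequently_atTop]
      intro k₀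
      have hS0 : 0 ≤ ∑ i ∈ Finset.range k₀, R i / μ i :=
        Finset.sum_nonneg fun i _ => div_nonneg (hR0 i) (hμpos i).le
      obtain ⟨k, hk⟩ := hb ((n : ℝ) + ∑ i ∈ Finset.range k₀, R i / μ i)
      refine ⟨k, ?_, ?_⟩
      · by_contra hlt
        push Not at hlt
        have h1 : R k / μ k ≤ ∑ i ∈ Finset.range k₀, R i / μ i :=
          Finset.single_le_sum (f := fun i => R i / μ i) (fun i _ => div_nonneg (hR0 i) (hμpos i).le)
            (Finset.mem_range.2 hlt)
        have h2 : R k = R k / μ k * μ k := (div_mul_cancel₀ _ (hμpos k).ne').symm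
        have h3 : R k / μ k * μ k ≤ (∑ i ∈ Finset.range k₀, R i / μ i) * μ k :=
          mul_le_mul_of_nonneg_right h1 (hμpos k).le
        nlinarith [hμpos k, (Nat.cast_nonneg n : (0 : ℝ) ≤ n)]
      · nlinarith [hμpos k]
    obtain ⟨σ, hσ, hσP⟩ := Filter.extraction_forall_of_frequently hfreq
    have hRpos : ∀ n, 0 < R (σ n) := fun n =>
      lt_of_le_of_lt (mul_nonneg (Nat.cast_nonneg n) (hμpos _).le) (hσP n)
    -- Dirichlet data along the subsequence
    have HD : ∀ n : ℕ, ∃ N : ℕ, ∃ j : ℤ,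
        |(N : ℝ) * θ₀ - (j : ℝ) * (2 * Real.pi)| * R (σ n) / μ (σ n) ≤ 2 * Real.pi * K * h + 2 ∧
        (N : ℝ) * h / μ (σ n) ≤ 2 * Real.pi * K * h + 2 ∧
        (1 ≤ |(N : ℝ) * θ₀ - (j : ℝ) * (2 * Real.pi)| * R (σ n) / μ (σ n) ∨ 1 ≤ (N : ℝ) * h / μ (σ n)) :=
      fun n => exists_offaxis_return θ₀ hh (hμh _) (hRpos n) hK (hRK _)
    choose N j hNa hNz hN1 using HD
    obtain ⟨A₀, hA₀⟩ : ∃ A₀ : ℝ, A₀ = 2 * Real.pi * K * h + 2 := ⟨_, rfl⟩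
    have hA₀pos : 0 < A₀ := by rw [hA₀]; positivity
    simp only [← hA₀] at hNa hNz
    obtain ⟨ψ, hψdef⟩ : ∃ ψ : ℕ → ℝ, ∀ n, ψ n = (N n : ℝ) * θ₀ - (j n : ℝ) * (2 * Real.pi) := ⟨_, fun _ => rfl⟩
    obtain ⟨c, hcdef⟩ : ∃ c : ℕ → E3, ∀ n, c n = x' (σ n) := ⟨_, fun _ => rfl⟩
    obtain ⟨d, hddef⟩ : ∃ d : ℕ → E3, ∀ n,
        d n = (μ (σ n))⁻¹ • (rotZ (ψ n) (c n) - c n + ((N n : ℝ) * h) • eZ) := ⟨_, fun _ => rfl⟩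
    have hc01 : ∀ n, c n 0 ^ 2 + c n 1 ^ 2 = R (σ n) ^ 2 := fun n => by rw [hRsq, hcdef]
    -- the residues tend to zero
    have hψbound : ∀ n, 1 ≤ n → |ψ n| ≤ A₀ / n := by
      intro n hn
      have hn' : (0 : ℝ) < n := by exact_mod_cast hn
      have h1 : |ψ n| * R (σ n) / μ (σ n) ≤ A₀ := by rw [hψdef]; exact hNa n
      have h2 : |ψ n| * R (σ n) ≤ A₀ * μ (σ n) := by rwa [div_le_iff₀ (hμpos _)] at h1
      have h3 : |ψ n| * ((n : ℝ) * μ (σ n)) ≤ |ψ n| * R (σ n) :=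
        mul_le_mul_of_nonneg_left (hσP n).le (abs_nonneg _)
      rw [le_div_iff₀ hn']
      nlinarith [hμpos (σ n), abs_nonneg (ψ n)]
    have hψlim : Tendsto ψ atTop (𝓝 0) := by
      have h0 : Tendsto (fun n : ℕ => A₀ / n) atTop (𝓝 0) := tendsto_const_div_atTop_nhds_zero_nat A₀
      rw [tendsto_zero_iff_norm_tendsto_zero]
      refine squeeze_zero' (Eventually.of_forall fun n => norm_nonneg _) ?_ h0
      exact (eventually_ge_atTop 1).mono fun n hn => by rw [Real.norm_eq_abs]; exact hψbound n hn
    -- the translations are bounded …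
    have hdbound : ∀ n, ‖d n‖ ≤ 2 * A₀ := by
      intro n
      have hμn := hμpos (σ n)
      have h1 : ‖rotZ (ψ n) (c n) - c n + ((N n : ℝ) * h) • eZ‖ ≤
          ‖rotZ (ψ n) (c n) - c n‖ + ‖((N n : ℝ) * h) • eZ‖ := norm_add_le _ _
      have h2 : ‖rotZ (ψ n) (c n) - c n‖ ≤ |ψ n| * R (σ n) := by
        rw [hRdef, ← hcdef]; exact norm_rotZ_sub_self_le _ _
      have h3 : ‖((N n : ℝ) * h) • eZ‖ = (N n : ℝ) * h := by
        rw [norm_smul, norm_eZ_eq_one, mul_one, Real.norm_eq_abs, abs_of_nonneg (by positivity)]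
      have h4 : |ψ n| * R (σ n) ≤ A₀ * μ (σ n) := by
        have := hNa n; rw [← hψdef] at this; rwa [div_le_iff₀ hμn] at this
      have h5 : (N n : ℝ) * h ≤ A₀ * μ (σ n) := by
        have := hNz n; rwa [div_le_iff₀ hμn] at this
      rw [hddef, norm_smul, norm_inv, Real.norm_eq_abs, abs_of_pos hμn, inv_mul_le_iff₀ hμn]
      linarith
    -- … and bounded below once the residue is at most π
    have hdlow : ∀ n, |ψ n| ≤ Real.pi → (1 : ℝ) / 4 ≤ ‖d n‖ ^ 2 := by
      intro n hψπ
      have hμn := hμpos (σ n)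
      have hμ0 : μ (σ n) ≠ 0 := hμn.ne'
      have e2 : d n 2 = (N n : ℝ) * h / μ (σ n) := by
        have h0 := rotZ_sub_self_apply_two (ψ n) (c n)
        rw [hddef]
        simp only [PiLp.smul_apply, PiLp.add_apply, smul_eq_mul, h0, zero_add]
        simp [eZ]
        field_simp
      have e01 : d n 0 ^ 2 + d n 1 ^ 2 =
          (μ (σ n))⁻¹ ^ 2 * ((rotZ (ψ n) (c n) - c n) 0 ^ 2 + (rotZ (ψ n) (c n) - c n) 1 ^ 2) := by
        rw [hddef]
        simp only [PiLp.smul_apply, PiLp.add_apply, smul_eq_mul]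
        simp [eZ]
        ring
      have hn2 : ‖d n‖ ^ 2 = d n 0 ^ 2 + d n 1 ^ 2 + d n 2 ^ 2 := by
        rw [EuclideanSpace.norm_eq, Real.sq_sqrt (Finset.sum_nonneg fun i _ => by positivity)]
        simp only [Fin.sum_univ_three, Real.norm_eq_abs, sq_abs]
      rw [hn2]
      rcases hN1 n with h1 | h1
      · rw [← hψdef] at h1
        have hge := horiz_sq_rotZ_sub_self_ge hψπ (c n)
        rw [hc01] at hge
        have hπ4 : Real.pi ≤ 4 := Real.pi_le_four
        have hπ0 : 0 < Real.pi := Real.pi_pos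
        have hq : 1 ≤ (|ψ n| * R (σ n) / μ (σ n)) ^ 2 := by nlinarith
        have hq' : (|ψ n| * R (σ n) / μ (σ n)) ^ 2 = (μ (σ n))⁻¹ ^ 2 * (ψ n ^ 2 * R (σ n) ^ 2) := by
          rw [div_eq_mul_inv, mul_pow, mul_pow, sq_abs]; ring
        have hkey : 4 / Real.pi ^ 2 * (μ (σ n))⁻¹ ^ 2 * (ψ n ^ 2 * R (σ n) ^ 2) ≤ d n 0 ^ 2 + d n 1 ^ 2 := by
          rw [e01]
          have := mul_le_mul_of_nonneg_left hge (sq_nonneg (μ (σ n))⁻¹)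
          nlinarith [this]
        have h16 : (1 : ℝ) / 4 ≤ 4 / Real.pi ^ 2 := by
          rw [div_le_div_iff₀ (by norm_num) (by positivity)]
          nlinarith
        have hprod : 4 / Real.pi ^ 2 * 1 ≤ 4 / Real.pi ^ 2 * ((μ (σ n))⁻¹ ^ 2 * (ψ n ^ 2 * R (σ n) ^ 2)) := by
          rw [← hq']; exact mul_le_mul_of_nonneg_left hq (by positivity)
        nlinarith [sq_nonneg (d n 2)]
      · rw [e2]
        have hq : 1 ≤ ((N n : ℝ) * h / μ (σ n)) ^ 2 := by nlinarith
        nlinarith [sq_nonneg (d n 0), sq_nonneg (d n 1)]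
    -- the off-axis zooms
    obtain ⟨v, hvdef⟩ : ∃ v : ℕ → ℝ → E3 → E3, ∀ n,
        v n = nsRescale (μ (σ n)) (fun t x => u t (c n + x)) := ⟨_, fun _ => rfl⟩
    have hvclass : ∀ n, IsTypeIAncientMild C (v n) := fun n => by
      rw [hvdef]; exact isTypeIAncientMild_nsRescale (isTypeIAncientMild_translate hu (c n)) (hμpos _)
    have hvsym : ∀ n, ∀ s < (0 : ℝ), ∀ y, v n s (rotZ (ψ n) y + d n) = rotZ (ψ n) (v n s y) := by
      intro n s hs y
      rw [hvdef, hddef, hψdef]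
      exact offaxis_zoom_symmetry hS (hμpos _) (c n) (N n) (j n) s hs y
    have hv0 : ∀ n, v n (-1) 0 = μ (σ n) • u (t (σ n)) (x' (σ n)) := by
      intro n
      rw [hvdef]
      simp only [nsRescale, smul_zero, add_zero, hcdef]
      congr 2
      rw [hμsq]; ring
    have hvlarge : ∀ n, ε < ‖v n (-1) 0‖ := by
      intro n
      rw [hv0, norm_smul, Real.norm_eq_abs, abs_of_pos (hμpos _)]
      exact hlarge _
    -- extraction (tree) and the marked value of the limit
    obtain ⟨φ, hφ, W, hW, -, -, hloc, -⟩ := exists_tendsto_of_isTypeIAncientMild_seq C (w := v) hvclass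
    have hW10 : ε ≤ ‖W (-1) 0‖ := by
      have hL : Tendsto (fun i => v (φ i) (-1) 0) atTop (𝓝 (W (-1) 0)) :=
        (hloc (-1) (by norm_num)).tendsto_comp (hW.continuous_slice (by norm_num)).continuousAt
          tendsto_const_nhds
      exact ge_of_tendsto hL.norm (Eventually.of_forall fun i => (hvlarge (φ i)).le)
    -- a convergent subsequence of the translations
    have hmem : ∀ i, d (φ i) ∈ Metric.closedBall (0 : E3) (2 * A₀) := fun i => by
      rw [Metric.mem_closedBall, dist_zero_right]; exact hdbound _
    obtain ⟨d₀, -, χ, hχ, hdlim⟩ := tendsto_subseq_of_bounded Metric.isBounded_closedBall hmem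
    have hdlim' : Tendsto (fun i => d (φ (χ i))) atTop (𝓝 d₀) := hdlim
    have hψlim' : Tendsto (fun i => ψ (φ (χ i))) atTop (𝓝 0) :=
      hψlim.comp ((hφ.comp hχ).tendsto_atTop)
    -- the limit is periodic …
    have hper : ∀ s < (0 : ℝ), ∀ y, W s (y + d₀) = W s y := by
      intro s hs y
      have hsub : TendstoLocallyUniformly (fun i => v (φ (χ i)) s) (W s) atTop :=
        tendstoLocallyUniformly_subseq (hloc s hs) hχ
      exact period_of_limit hsub (hW.continuous_slice hs) hψlim' hdlim' (fun i y => hvsym _ s hs y) y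
    -- … with a non-zero period
    have hd₀ : d₀ ≠ 0 := by
      have hsq : Tendsto (fun i => ‖d (φ (χ i))‖ ^ 2) atTop (𝓝 (‖d₀‖ ^ 2)) := (hdlim'.norm).pow 2
      have hev : ∀ᶠ i in atTop, (1 : ℝ) / 4 ≤ ‖d (φ (χ i))‖ ^ 2 := by
        have h1 : ∀ᶠ i in atTop, ‖ψ (φ (χ i))‖ < Real.pi :=
          (hψlim'.norm).eventually (gt_mem_nhds (by rw [norm_zero]; exact Real.pi_pos))
        exact h1.mono fun i hi => hdlow _ (by rw [Real.norm_eq_abs] at hi; exact hi.le)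
      have h14 : (1 : ℝ) / 4 ≤ ‖d₀‖ ^ 2 := ge_of_tendsto hsq hev
      intro h0
      rw [h0, norm_zero] at h14
      norm_num at h14
    -- hence zero by the tree's periodic Liouville theorem: contradiction with the marked value
    have hWz := ScenarioCensus.PeriodicGauge.periodic_typeI_liouville_genuine C W hW d₀ hd₀ hper (-1)
      (by norm_num) 0
    rw [hWz, norm_zero] at hW10
    exact absurd hW10 (not_le.2 hε)

/-- **Far-past smallness on LINEAR CONES (v1.5, PROVED)**, any non-zero drift (negative drift via the inverse screw). -/
theorem farPast_linearCone_smallness_of_screw {C : ℝ} {u : ℝ → E3 → E3} {θ₀ h : ℝ}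
    (hu : IsTypeIAncientMild C u) (hθ : Irrational (θ₀ / (2 * Real.pi))) (hh : h ≠ 0)
    (hS : IsScrewEquivariant θ₀ h u) :
    ∀ ε > (0 : ℝ), ∀ K > (0 : ℝ), ∃ T < (0 : ℝ), ∀ t < T, ∀ x : E3,
      x 0 ^ 2 + x 1 ^ 2 ≤ K ^ 2 * t ^ 2 → Real.sqrt (-t) * ‖u t x‖ ≤ ε := by
  rcases lt_or_gt_of_ne hh with hneg | hpos
  · have hθ' : Irrational (-θ₀ / (2 * Real.pi)) := by rw [neg_div]; exact hθ.neg
    exact farPast_linearCone_smallness_of_screw_pos hu hθ' (neg_pos.2 hneg) (isScrewEquivariant_inv hS)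
  · exact farPast_linearCone_smallness_of_screw_pos hu hθ hpos hS

end Summit.NavierStokesRegularity.NavierStokesRegularity.Theorems.ScenarioCensus.ScrewBlowdown
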